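import Literature.NumberTheory.EllipticCurves.ConstantKernelIsogenySelmerInertia
import Literature.NumberTheory.EllipticCurves.OpenImageMazurCharacterProofs
import HarnessLib

/-!
# The Selmer group of an isogeny with constant kernel over `ℚ` vanishes when the model is good at
# the primes dividing the degree and every other bad prime `ℓ` has `gcd(n, ℓ - 1) = 1`

PROOF-ONLY file (theorems, no definition, no named fact), topic `NumberTheory/EllipticCurves`.
This is the global half of Mazur's descent through a constant étale kernel (B. Mazur, *Modular
curves and the Eisenstein ideal*, Publ. Math. IHÉS 47 (1977), Ch. III §3 with Ch. I §1(g): over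
`S = Spec ℤ[1/N]`, `h¹(S, ℤ/p)` counts the `ℤ/p`-extensions of `ℚ` unramified outside `N`; they
ramify only at `p` and at primes `ℓ ≡ 1 (mod p)`), in the régime where NO class field theory
input beyond Minkowski's theorem is needed.

**Theorem** (`selmerGroup_eq_bot`). Let `E/ℚ` be an elliptic curve with an integral equation
`W = W₀ ⊗ ℚ`, `φ : E → E'` an isogeny whose kernel `E[φ] ⊆ E(ℚ̄)` is fixed pointwise by `Γ_ℚ`,
killed by `n ≥ 1`, and whose non-zero points are affine with integer coordinates. Suppose that
every prime `ℓ` satisfies one of: (étale) `ℓ ∤ Δ(W₀)`; (tame) `ℓ ∤ n` and `gcd(n, ℓ - 1) = 1`.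
Then `Sel^φ(E/ℚ) = 0`.

*Proof.* A Selmer class is a continuous homomorphism `χ : Γ_ℚ → E[φ]`
(`ConstantKernelDescent.cocycle_mul_of_constant`), which vanishes on every inertia group: at étale
primes by the local Selmer condition and the reduction engine
(`ConstantKernelDescent.apply_eq_zero_of_mem_inertia_of_val_Δ`), at tame primes by the structure of
tame inertia (`ConstantKernelDescent.apply_eq_zero_of_mem_inertia_of_coprime`). A character of
`Γ_ℚ` with open kernel vanishing on all inertia groups is trivial — `ℚ` has no unramified
extensions (Minkowski; the tree's `Mazur1978.monoidHom_eq_one_of_forall_inertia`, from Cassels'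
"arithmetic monodromy" `NumberFields.iSup_inertia_eq_top`).

**Corollaries** (Silverman, *AEC*, Thm. X.4.2(a): `0 → E'(ℚ)/φE(ℚ) → Sel^φ → Ш(E/ℚ)[φ] → 0`,
tree `Isogeny.natCard_selmerGroup_eq`): `exists_toGeomPoints_eq_of_rational` — **`E'(ℚ) = φ(E(ℚ))`**;
`ker_shaMap_eq_bot` — **`Ш(E/ℚ)[φ] = ker (Ш(E/ℚ) → Ш(E'/ℚ)) = 0`**.

Typical use (the `5`-descent on the Kubert–Tate family `y² + (1-t)xy - ty = x³ - tx²`,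
`T = (0,0)` of order `5`, `φ : E → E/⟨T⟩`): `n = 5`, `W₀ = [n-m, -mn, -mn², 0, 0]` for `t = m/n`,
étale primes = the primes not dividing `mn(m² - 11mn - n²)` (including `5` when `5 ∤ Δ`), tame
primes = the bad primes `≢ 1 (mod 5)`; so `Sel^φ = 0` as soon as `5 ∤ Δ` and no bad prime is
`≡ 1 (mod 5)` (compare `11A3 → 11A1`, where the bad prime `11 ≡ 1 (mod 5)` carries the one
non-trivial class, `X1ElevenDescentGalois`).

## References

* [Mazur1977] B. Mazur, *Modular curves and the Eisenstein ideal*, Publ. Math. IHÉS 47 (1977),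
  Ch. I §1(g) (p. 48), Ch. III §3 Thm. (3.1), Ch. III §5 (pp. 157–160).
* [SilvermanAEC2009] J. H. Silverman, *The Arithmetic of Elliptic Curves*, 2nd ed., Thm. X.4.2.
* [Cassels1986] J. W. S. Cassels, *Local Fields*, Ch. 10 Thm. 12.1.

## Design

Theorems only. The hypothesis on the primes is phrased place by place on
`v : HeightOneSpectrum (𝓞 ℚ)` (`(Δ : 𝓞 ℚ) ∉ v` or `(n : 𝓞 ℚ) ∉ v ∧ Nat.Coprime n (N v - 1)`), the
form consumed by the two local lemmas; the map on rational points enters as data `f` with its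
characterising property (`Isogeny.exists_pointHom`), as in `IsogenyKummerSequenceProofs`.
-/

noncomputable section

open scoped Classical Pointwise
open NumberField IsDedekindDomain Field
open Literature.NumberTheory.EllipticCurves Literature.NumberTheory.GaloisRepresentations

universe u

namespace Literature.NumberTheory.EllipticCurves

namespace ConstantKernelDescent

/-! ## Consequences of `Sel^φ = 0` over any number field (Silverman X.4.2(a)) -/

section Generic

variable {K : Type u} [Field K] [NumberField K] {W W' : WeierstrassCurve K} [W.IsElliptic]
  [W'.IsElliptic] (φ : WeierstrassCurve.Isogeny W W')

/-- **`Sel^φ(E/K) = 0 ⟹ E'(K) = φ(E(K))`**: every rational point of `E'` is the image of a rational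
point of `E`. From Silverman X.4.2(a) in the tree's counting form
`#Sel^φ = [E'(K) : φE(K)] · #Ш(E/K)[φ]` (`Isogeny.natCard_selmerGroup_eq`, the map on rational
points being `Isogeny.exists_pointHom`). [cite: SilvermanAEC2009, Thm. X.4.2(a)] -/
theorem exists_toGeomPoints_eq_of_selmerGroup_eq_bot (h : φ.selmerGroup = ⊥)
    (P' : W'.toAffine.Point) : ∃ P : W.toAffine.Point, W'.toGeomPoints P' = φ (W.toGeomPoints P) := by
  obtain ⟨f, hf⟩ := φ.exists_pointHom
  have hcard := φ.natCard_selmerGroup_eq f hf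
  rw [h, AddSubgroup.card_bot, eq_comm] at hcard
  have hidx : f.range.index = 1 := Nat.eq_one_of_mul_eq_one_right hcard
  have htop : f.range = ⊤ := AddSubgroup.index_eq_one.mp hidx
  have hP' : P' ∈ f.range := by rw [htop]; exact AddSubgroup.mem_top P'
  obtain ⟨P, rfl⟩ := hP'
  exact ⟨P, hf P⟩

/-- **`Sel^φ(E/K) = 0 ⟹ Ш(E/K)[φ] = 0`**: the kernel of `Ш(φ) : Ш(E/K) → Ш(E'/K)` (tree `shaMap`) is
trivial. From `#Sel^φ = [E'(K) : φE(K)] · #Ш(E/K)[φ]` (`Isogeny.natCard_selmerGroup_eq`; both factors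
are finite). [cite: SilvermanAEC2009, Thm. X.4.2(a)] -/
theorem ker_shaMap_eq_bot_of_selmerGroup_eq_bot (h : φ.selmerGroup = ⊥) :
    (shaMap φ.toAddMonoidHom φ.equivariant φ.hasLocalPointsMaps_toAddMonoidHom).ker = ⊥ := by
  obtain ⟨f, hf⟩ := φ.exists_pointHom
  have hcard := φ.natCard_selmerGroup_eq f hf
  rw [h, AddSubgroup.card_bot, eq_comm] at hcard
  exact AddSubgroup.card_eq_one.mp (Nat.eq_one_of_mul_eq_one_left hcard)

end Generic

/-! ## Over `ℚ`: the Selmer group vanishes -/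

variable {W W' : WeierstrassCurve ℚ} [W.IsElliptic] [W'.IsElliptic]
  (φ : WeierstrassCurve.Isogeny W W')

omit [W.IsElliptic] [W'.IsElliptic] in
/-- **A constant-kernel cocycle over `ℚ` vanishing on every inertia group is zero** (`ℚ` has no
unramified extensions: Minkowski, in the Galois-character form
`Mazur1978.monoidHom_eq_one_of_forall_inertia`). [cite: Mazur1977, Ch. I §1(g)]
[cite: Cassels1986, Ch. 10 §12, Thm. 12.1 (p. 235)] -/
theorem cocycle_eq_zero_of_forall_inertia
    (hconst : ∀ (σ : absoluteGaloisGroup ℚ) (P : W.geomPoints), P ∈ φ.toAddMonoidHom.ker → σ • P = P)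
    (ψ : letI := φ.kerAction
      contOneCocycles (discreteTopRep (absoluteGaloisGroup ℚ) φ.toAddMonoidHom.ker))
    (h : ∀ (v : HeightOneSpectrum (𝓞 ℚ)), ∀ 𝔓 ∈ v.primesAbove,
      ∀ τ ∈ 𝔓.inertia (absoluteGaloisGroup ℚ), ψ.1 τ = 0) (σ : absoluteGaloisGroup ℚ) :
    ψ.1 σ = 0 := by
  letI := φ.kerAction
  have h1 : ψ.1 1 = 0 := contOneCocycles.apply_one ψ
  let χ : absoluteGaloisGroup ℚ →* Multiplicative φ.toAddMonoidHom.ker :=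
    { toFun := fun s ↦ Multiplicative.ofAdd (ψ.1 s)
      map_one' := by rw [h1]; rfl
      map_mul' := fun s t ↦ by
        rw [cocycle_mul_of_constant φ hconst ψ s t, ofAdd_add] }
  have hχ : ∀ s, χ s = Multiplicative.ofAdd (ψ.1 s) := fun s ↦ rfl
  have hker : IsOpen ((χ.ker : Subgroup (absoluteGaloisGroup ℚ)) : Set (absoluteGaloisGroup ℚ)) := by
    have hset : ((χ.ker : Subgroup (absoluteGaloisGroup ℚ)) : Set (absoluteGaloisGroup ℚ)) =
        ψ.1 ⁻¹' {0} := by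
      ext s
      rw [SetLike.mem_coe, MonoidHom.mem_ker, hχ, Set.mem_preimage, Set.mem_singleton_iff]
      exact ofAdd_eq_one
    rw [hset]
    exact (isOpen_discrete _).preimage ψ.1.continuous
  have hone := Mazur1978.monoidHom_eq_one_of_forall_inertia χ hker (fun v 𝔓 h𝔓 τ hτ ↦ by
    rw [hχ, h v 𝔓 h𝔓 τ hτ]; rfl)
  have h2 : χ σ = 1 := by rw [hone]; rfl
  rw [hχ] at h2
  exact ofAdd_eq_one.mp h2

omit [W'.IsElliptic] in
/-- **`Sel^φ(E/ℚ) = 0` for an isogeny with constant étale kernel in the tame régime** (main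
theorem; statement and proof in the module docstring): `W = W₀ ⊗ ℚ` integral, `Γ_ℚ` fixes `E[φ]`
pointwise, `n • E[φ] = 0`, the non-zero kernel points are integral affine points, and every finite
place `v` is étale (`Δ(W₀) ∉ v`) or tame (`n ∉ v`, `gcd(n, N v - 1) = 1`).
[cite: Mazur1977, Ch. III §3 Thm. (3.1) with Ch. I §1(g)] -/
theorem selmerGroup_eq_bot (W₀ : WeierstrassCurve ℤ) (hW : W = W₀.map (Int.castRingHom ℚ))
    (hconst : ∀ (σ : absoluteGaloisGroup ℚ) (P : W.geomPoints), P ∈ φ.toAddMonoidHom.ker → σ • P = P)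
    (hint : ∀ P : W.geomPoints, P ∈ φ.toAddMonoidHom.ker → P ≠ 0 →
      ∃ (a b : ℤ) (h : (W.baseChange (AlgebraicClosure ℚ)).toAffine.Nonsingular
        (a : AlgebraicClosure ℚ) (b : AlgebraicClosure ℚ)),
        P = WeierstrassCurve.Affine.Point.some _ _ h)
    {n : ℕ} (hn : 0 < n) (hkill : ∀ P : W.geomPoints, P ∈ φ.toAddMonoidHom.ker → n • P = 0)
    (hv : ∀ v : HeightOneSpectrum (𝓞 ℚ), ((W₀.Δ : ℤ) : 𝓞 ℚ) ∉ v.asIdeal ∨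
      ((n : 𝓞 ℚ) ∉ v.asIdeal ∧ Nat.Coprime n (v.residueCard - 1))) :
    φ.selmerGroup = ⊥ := by
  letI := φ.kerAction
  rw [eq_bot_iff]
  intro c hc
  obtain ⟨ψ, rfl⟩ := oneCocycleClass_surjective
    (discreteTopRep (absoluteGaloisGroup ℚ) φ.toAddMonoidHom.ker) c
  have hloc := ((φ.mem_selmerGroup_iff _).mp hc).1
  have hzero : ∀ σ, ψ.1 σ = 0 := by
    refine cocycle_eq_zero_of_forall_inertia φ hconst ψ fun v 𝔓 h𝔓 τ hτ ↦ ?_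
    rcases hv v with hΔ | ⟨hnv, hcop⟩
    · exact apply_eq_zero_of_mem_inertia_of_val_Δ φ W₀ hW hconst hint hΔ ψ (hloc v) h𝔓 hτ
    · exact apply_eq_zero_of_mem_inertia_of_coprime φ hconst hn hkill hnv hcop ψ h𝔓 hτ
  rw [AddSubgroup.mem_bot, oneCocycleClass_eq_zero_iff]
  exact ⟨0, fun g ↦ by rw [hzero g, map_zero, sub_zero]⟩

/-- **`E'(ℚ) = φ(E(ℚ))`** under the hypotheses of `selmerGroup_eq_bot`: every rational point of
`E'` is the image under `φ` of a rational point of `E`.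
[cite: SilvermanAEC2009, Thm. X.4.2(a)] [cite: Mazur1977, Ch. III §3 Thm. (3.1)] -/
theorem exists_toGeomPoints_eq_of_rational (W₀ : WeierstrassCurve ℤ)
    (hW : W = W₀.map (Int.castRingHom ℚ))
    (hconst : ∀ (σ : absoluteGaloisGroup ℚ) (P : W.geomPoints), P ∈ φ.toAddMonoidHom.ker → σ • P = P)
    (hint : ∀ P : W.geomPoints, P ∈ φ.toAddMonoidHom.ker → P ≠ 0 →
      ∃ (a b : ℤ) (h : (W.baseChange (AlgebraicClosure ℚ)).toAffine.Nonsingular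
        (a : AlgebraicClosure ℚ) (b : AlgebraicClosure ℚ)),
        P = WeierstrassCurve.Affine.Point.some _ _ h)
    {n : ℕ} (hn : 0 < n) (hkill : ∀ P : W.geomPoints, P ∈ φ.toAddMonoidHom.ker → n • P = 0)
    (hv : ∀ v : HeightOneSpectrum (𝓞 ℚ), ((W₀.Δ : ℤ) : 𝓞 ℚ) ∉ v.asIdeal ∨
      ((n : 𝓞 ℚ) ∉ v.asIdeal ∧ Nat.Coprime n (v.residueCard - 1)))
    (P' : W'.toAffine.Point) :
    ∃ P : W.toAffine.Point, W'.toGeomPoints P' = φ (W.toGeomPoints P) :=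
  exists_toGeomPoints_eq_of_selmerGroup_eq_bot φ
    (selmerGroup_eq_bot φ W₀ hW hconst hint hn hkill hv) P'

/-- **`Ш(E/ℚ)[φ] = 0`** under the hypotheses of `selmerGroup_eq_bot`: the kernel of
`Ш(φ) : Ш(E/ℚ) → Ш(E'/ℚ)` (tree `shaMap`) is trivial.
[cite: SilvermanAEC2009, Thm. X.4.2(a)] [cite: Mazur1977, Ch. III §3 Thm. (3.1)] -/
theorem ker_shaMap_eq_bot (W₀ : WeierstrassCurve ℤ) (hW : W = W₀.map (Int.castRingHom ℚ))
    (hconst : ∀ (σ : absoluteGaloisGroup ℚ) (P : W.geomPoints), P ∈ φ.toAddMonoidHom.ker → σ • P = P)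
    (hint : ∀ P : W.geomPoints, P ∈ φ.toAddMonoidHom.ker → P ≠ 0 →
      ∃ (a b : ℤ) (h : (W.baseChange (AlgebraicClosure ℚ)).toAffine.Nonsingular
        (a : AlgebraicClosure ℚ) (b : AlgebraicClosure ℚ)),
        P = WeierstrassCurve.Affine.Point.some _ _ h)
    {n : ℕ} (hn : 0 < n) (hkill : ∀ P : W.geomPoints, P ∈ φ.toAddMonoidHom.ker → n • P = 0)
    (hv : ∀ v : HeightOneSpectrum (𝓞 ℚ), ((W₀.Δ : ℤ) : 𝓞 ℚ) ∉ v.asIdeal ∨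
      ((n : 𝓞 ℚ) ∉ v.asIdeal ∧ Nat.Coprime n (v.residueCard - 1))) :
    (shaMap φ.toAddMonoidHom φ.equivariant φ.hasLocalPointsMaps_toAddMonoidHom).ker = ⊥ :=
  ker_shaMap_eq_bot_of_selmerGroup_eq_bot φ (selmerGroup_eq_bot φ W₀ hW hconst hint hn hkill hv)

/-- **No rational `φ`-torsion in `Ш(E/ℚ)`**, elementwise: under the hypotheses of
`selmerGroup_eq_bot`, a class of `Ш(E/ℚ)` killed by `Ш(φ)` is zero.
[cite: SilvermanAEC2009, Thm. X.4.2(a)] [cite: Mazur1977, Ch. III §3 Thm. (3.1)] -/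
theorem eq_zero_of_shaMap_eq_zero (W₀ : WeierstrassCurve ℤ) (hW : W = W₀.map (Int.castRingHom ℚ))
    (hconst : ∀ (σ : absoluteGaloisGroup ℚ) (P : W.geomPoints), P ∈ φ.toAddMonoidHom.ker → σ • P = P)
    (hint : ∀ P : W.geomPoints, P ∈ φ.toAddMonoidHom.ker → P ≠ 0 →
      ∃ (a b : ℤ) (h : (W.baseChange (AlgebraicClosure ℚ)).toAffine.Nonsingular
        (a : AlgebraicClosure ℚ) (b : AlgebraicClosure ℚ)),
        P = WeierstrassCurve.Affine.Point.some _ _ h)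
    {n : ℕ} (hn : 0 < n) (hkill : ∀ P : W.geomPoints, P ∈ φ.toAddMonoidHom.ker → n • P = 0)
    (hv : ∀ v : HeightOneSpectrum (𝓞 ℚ), ((W₀.Δ : ℤ) : 𝓞 ℚ) ∉ v.asIdeal ∨
      ((n : 𝓞 ℚ) ∉ v.asIdeal ∧ Nat.Coprime n (v.residueCard - 1)))
    {c : W.sha}
    (hc : shaMap φ.toAddMonoidHom φ.equivariant φ.hasLocalPointsMaps_toAddMonoidHom c = 0) :
    c = 0 := by
  have hmem : c ∈ (shaMap φ.toAddMonoidHom φ.equivariant φ.hasLocalPointsMaps_toAddMonoidHom).ker :=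
    (AddMonoidHom.mem_ker).mpr hc
  rw [ker_shaMap_eq_bot φ W₀ hW hconst hint hn hkill hv] at hmem
  exact (AddSubgroup.mem_bot).mp hmem

end ConstantKernelDescent

end Literature.NumberTheory.EllipticCurves

end
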